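/-
Copyright (c) 2026 the pub-hodgecm-mathlib formalisation cell (harness21).  Prover seat hodgecm-mathlib-F0P3a-p03 (g17): «S3-ram» seeding wave (LEAD F0P3a-plan (g12)
T11-88∕T11-90; owner F0P3a-p06 (g15)), the (Lit2) «TYPE-(2) v-DEEP LITERALS» organ, first half: THE FRAME LITERAL and its κ-sign; 2026-09-02.
-/
import Literature.NumberTheory.Rogawski1990.LocalNormPairOfSimilitudeFrame                  -- ★ p847288 (this seat): the similitude-frame transport `localNonsplitCongr`, `endoEmbLocal`
import Literature.NumberTheory.Rogawski1990.UnitFundamentalLemmaRamifiedFlickerKappaSigns      -- ★ (F0P3b-p01): one-place κ-reading machinery (`finKappaAt_eq_ite_of_eigenvector` bridge)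
import Literature.NumberTheory.Rogawski1990.UnitFundamentalLemmaInertFlickerFrame             -- ★ `coe_localNonsplitEquiv_endoEmbLocal`, `coe_endoGL_eq`
import Literature.NumberTheory.Rogawski1990.RamifiedPlaceNormSymbolDichotomy                  -- ★ (A-p03): `hilbertSymbol_eq_one_iff_exists_norm_toPlace`
import Literature.NumberTheory.Automorphic.RamifiedPlaceEisensteinBasis                       -- ★ `valued_toPlace_eq_sq_of_ramified`
import Literature.NumberTheory.Rogawski1990.TwoDeepRepresentativesTypeTwoLocal               -- ★ `stdForm_antidiagonal_three_over_eq`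
import HarnessLib

/-!
# The type-(2) FRAME LITERAL at a non-split place: `t₀ := ψ_A⁻¹(ι_v γ_H)`, its one-place matrix `A⁻¹ · ι(g_w, u_w) · A`, its depth, and its κ-sign
# `κ_v(γ_H, t₀) = (y_λ, θ)_v` (Rogawski 1990 §4.3, §4.9; Langlands–Shelstad)

Topic `NumberTheory/Rogawski1990`; namespace `Literature.NumberTheory.Rogawski1990`.  THEOREMS ONLY (no definition, no named fact, no instance, no notation, no `sorry`);
kernel lane `--supports stmt-HodgeConjecture-24833`.  Cell `pub/hodgecm-mathlib`, crux H413; «S3-ram» seeding wave (Literature seeding, count-neutral), the (Lit2) socket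
`stub_typeTwo_literals_{even,odd}_ram` of fold v7.6 (= the `hLit` hypothesis of ★ `typeTwo_GSideNhds_{even,odd}_ram_of_literals_of_counts`, p847515∕p847517):
«on the 2-deep tube both matched classes of a type-(2) `γ_H` contain v-DEEP elements `t₊`, `t₋` (`κ_v = +1, −1`)».  THIS FILE supplies the literal of sign `(y_λ, θ)_v`:
* §1 **`κ_v` READ ON A ONE-PLACE EIGENVECTOR** (`finKappaAt_eq_ite_of_onePlace_eigenvector`): for a match `(γ_H, t)` with `χ_g(u)` a unit and a `u_w`-eigenvector `q ∈ L_w³`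
  of `t_w` of non-zero `H′_w`-length `ℓ(q) = ᵗσ̄q·H′_w·q`: `κ_v(γ_H, t) = +1 ⟺ ℓ(q) ∈ N(L_w^×)` (the eigenVECTOR twin of ★ `finKappaAt_eq_ite_of_onePlace_frame`, which wants a
  full eigenframe and so only serves type (1));
* §2 **THE FRAME LITERAL** (`exists_isLocalNormPair_coe_eq_of_frame`): from the wave's frame token `H′_w = (−det H′_w) • ᵗσ̄A·Φ₃·A` every `γ_H` has a match `t₀ ∈ G′_v` whose
  one-place matrix IS `A⁻¹ · ι(g_w, u_w) · A` (★ p847288 gave the match, this edition exports the matrix);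
* §3 **ITS κ-SIGN** (`finKappaAt_eq_ite_of_coe_eq_of_frame`, `finKappaAt_eq_hilbertSymbol_of_coe_eq_of_frame`): the `u_w`-eigenvector `A⁻¹e₁` has length `−det H′_w`, so
  `κ_v(γ_H, t₀) = +1 ⟺ −det H′_w ∈ N(L_w^×) ⟺ (y_λ, θ)_v = 1` for the wave's `ι_w y_λ = −det H′_w` (★ `hilbertSymbol_eq_one_iff_exists_norm_toPlace`): `κ_v(γ_H, t₀) = (y_λ, θ)_v`;
* §4 **ITS DEPTH** (`vDeep_of_coe_eq_conj_of_entrywise_le` — conjugate-general: one-place matrix `A⁻¹·Y·A` with `Y ≡ 1 (mod ϖ_w²)`, for the literals lineage — and `vDeep_of_coe_eq_of_frame`): `A ∈ GL₃(𝒪_w)` and `γ_H` in the 2-deep tube (`g_w ≡ 1`, `u_w ≡ 1 (mod ϖ_w²)`) give `t₀ ≡ 1 (mod ϖ_w²) = (mod ι_w ϖ_v)`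
  at a ramified `w` — the «v-DEEP» clause of the (Lit2) socket verbatim;
* §5 **PACKAGE** (`exists_vDeep_frameLiteral_ram`): `∃ t₀`, matched, v-deep, `κ_v(γ_H, t₀) = (y_λ, θ)_v`.
The literal of the OPPOSITE sign (the «𝒪_{E_W}-line ⊕ ε-line» lattice, not a similitude conjugate of `t₀` in odd rank) is the organ's second half (literals lineage).
HONEST LABEL: HC_CM is proved only modulo the 2 remaining named inputs (hLiu418 24832, h413 24833) until rung 0 closes; Literature seeding, no books consequence.

## References
* [Rogawski1990] J. D. Rogawski, *Automorphic Representations of Unitary Groups in Three Variables*, Ann. of Math. Stud. 123 (1990), §3.5 Prop. 3.5.2 (c) p. 29, §4.3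
  (4.3.2) p. 43, §4.9 Prop. 4.9.1 p. 55, §14.2 p. 233.
* [LanglandsShelstad1987] R. P. Langlands, D. Shelstad, *On the definition of transfer factors*, Math. Ann. 278 (1987), §1.
* [Jacobowitz1962] R. Jacobowitz, *Hermitian forms over local fields*, Amer. J. Math. 84 (1962), §7–§8.
-/

set_option autoImplicit false

noncomputable section

open NumberField IsDedekindDomain Matrix Topology
open scoped Matrix MatrixGroups Classical

namespace Literature.NumberTheory.Rogawski1990

open Literature.NumberTheory.Automorphic Literature.NumberTheory.Automorphic.UnitaryGroup Literature.NumberTheory.GaloisRepresentations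
open Literature.NumberTheory.QuadraticForms

section CM

variable (L : Type) [Field L] [NumberField L] [IsCMField L] (H' : Matrix (Fin 3) (Fin 3) L)
  {v : HeightOneSpectrum (𝓞 ↥(maximalRealSubfield L))}

/-! ## §1 `κ_v` read on a one-place eigenvector -/

/-- **`κ_v(γ_H, t)` ON A ONE-PLACE `u_w`-EIGENVECTOR.**  `v` non-split, `(γ_H, t)` matched with `χ_g(u)` a unit, `t_w · q = u_w · q` for a vector `q ∈ L_w³` whose `H′_w`-length
`ℓ(q) = Σ σ_w(q_i) (H′_w)_{ik} q_k` is non-zero.  Then `κ_v(γ_H, t) = +1` iff `ℓ(q) = σ_w(z) z` for some `z ∈ L_w`.  (★ `finKappaAt_eq_ite_of_eigenvector` with `q` lifted to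
`E_v` along the unique place `w`; eigenvector twin of ★ `finKappaAt_eq_ite_of_onePlace_frame`.) [cite: Rogawski1990, §4.3 (4.3.2) p. 43; §3.5 Prop. 3.5.2 (c) p. 29]
[cite: LanglandsShelstad1987, §1] -/
theorem finKappaAt_eq_ite_of_onePlace_eigenvector (w : PlacesOver L v) (hw : IsCMField.complexConj L • w.1 = w.1)
    (γH : (cmDatum L 2 (Matrix.of fun i j : Fin 2 => if i.val + j.val + 1 = 2 then (1 : L) else 0)).Local v ×
      (cmDatum L 1 (Matrix.of fun i j : Fin 1 => if i.val + j.val + 1 = 1 then (1 : L) else 0)).Local v)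
    (hu : IsUnit ((finCharpolyTwo L v γH).eval (finGammaTwo L v γH)))
    {t : (cmDatum L 3 H').Local v} (ht : IsLocalNormPair L H' v γH t)
    {q : Fin 3 → w.1.adicCompletion L}
    (hq : (((localNonsplitEquiv (IsCMField.complexConj L) H' (IsCMField.complexConj_ne_one L) w hw t).val :
        GL (Fin 3) (w.1.adicCompletion L)) : Matrix (Fin 3) (Fin 3) (w.1.adicCompletion L)) *ᵥ q = finGammaTwo L v γH w • q)
    (hq0 : q ≠ 0)
    (hlen : (∑ i : Fin 3, ∑ k : Fin 3, galAdicCompletionMap (L := L) (IsCMField.complexConj L) hw (q i) * placeForm H' w.1 i k * q k) ≠ 0) :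
    finKappaAt L v H' γH t =
      if ∃ z : w.1.adicCompletion L, galAdicCompletionMap (L := L) (IsCMField.complexConj L) hw z * z =
          ∑ i : Fin 3, ∑ k : Fin 3, galAdicCompletionMap (L := L) (IsCMField.complexConj L) hw (q i) * placeForm H' w.1 i k * q k
      then 1 else -1 := by
  classical
  have hc := IsCMField.complexConj_ne_one L
  haveI : Algebra.IsQuadraticExtension ↥(maximalRealSubfield L) L := IsCMField.isQuadraticExtension L
  have hvs : Subsingleton (PlacesOver L v) := PlacesOver.subsingleton_of_smul_eq (IsCMField.complexConj L) hc w hw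
  letI : Unique (PlacesOver L v) := @uniqueOfSubsingleton _ hvs w
  -- the `w`-component of `t` is the one-place model matrix
  have htw : ∀ i k, (t.val.val : Matrix (Fin 3) (Fin 3) (UnitaryGroup.LocalRing L v)) i k w =
      (((localNonsplitEquiv (IsCMField.complexConj L) H' hc w hw t).val : GL (Fin 3) (w.1.adicCompletion L)) :
        Matrix (Fin 3) (Fin 3) (w.1.adicCompletion L)) i k := fun i k => by
    have h := congr_fun (congr_fun (coe_localNonsplitEquiv_apply L H' v w hw t) i) k
    rw [h, Matrix.map_apply]; rfl
  -- the eigenvector lifted along the unique place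
  obtain ⟨p', hp'w⟩ : ∃ p' : Fin 3 → UnitaryGroup.LocalRing L v, ∀ i, p' i w = q i :=
    ⟨fun i => (RingEquiv.piUnique fun w' : PlacesOver L v => w'.1.adicCompletion L).symm (q i),
      fun i => (RingEquiv.piUnique fun w' : PlacesOver L v => w'.1.adicCompletion L).apply_symm_apply _⟩
  have hne : p' ≠ 0 := fun h0 => hq0 (by
    funext i; rw [← hp'w i, h0, Pi.zero_apply, Pi.zero_apply, Pi.zero_apply])
  have hp' : (t.val.val : Matrix (Fin 3) (Fin 3) (UnitaryGroup.LocalRing L v)) *ᵥ p' = finGammaTwo L v γH • p' := by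
    funext i
    rw [LocalRing.eq_iff_apply_eq (IsCMField.complexConj L) hc w hw]
    simp only [Matrix.mulVec, dotProduct, Finset.sum_apply, Pi.mul_apply, Pi.smul_apply, smul_eq_mul, htw, hp'w]
    have h := congr_fun hq i
    simp only [Matrix.mulVec, dotProduct, Pi.smul_apply, smul_eq_mul] at h
    exact h
  -- the `H′`-value of `p′` read at `w` is `ℓ(q)`
  have hxw : (∑ i : Fin 3, ∑ k : Fin 3, UnitaryGroup.conjLocal L (IsCMField.complexConj L) v (p' i) *
      ((UnitaryGroup.adelicForm L 3 H').map (UnitaryGroup.adeleToLocal L v)) i k * p' k) w =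
        ∑ i : Fin 3, ∑ k : Fin 3, galAdicCompletionMap (L := L) (IsCMField.complexConj L) hw (q i) * placeForm H' w.1 i k * q k := by
    simp only [Finset.sum_apply, Pi.mul_apply, conjLocal_apply_eq_galAdicCompletionMap L v w hw, localGram_apply_apply, hp'w]
  rw [finKappaAt_eq_ite_of_eigenvector L v H' γH t hvs ht hu hp' hne]
  have hiff : (∃ z : UnitaryGroup.LocalRing L v, IsUnit z ∧
      (∑ i : Fin 3, ∑ k : Fin 3, UnitaryGroup.conjLocal L (IsCMField.complexConj L) v (p' i) *
        ((UnitaryGroup.adelicForm L 3 H').map (UnitaryGroup.adeleToLocal L v)) i k * p' k) =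
        z * UnitaryGroup.conjLocal L (IsCMField.complexConj L) v z) ↔
      ∃ z : w.1.adicCompletion L, galAdicCompletionMap (L := L) (IsCMField.complexConj L) hw z * z =
        ∑ i : Fin 3, ∑ k : Fin 3, galAdicCompletionMap (L := L) (IsCMField.complexConj L) hw (q i) * placeForm H' w.1 i k * q k := by
    constructor
    · rintro ⟨z, -, hz⟩
      refine ⟨z w, ?_⟩
      have h := congr_fun hz w
      rw [hxw, Pi.mul_apply, conjLocal_apply_eq_galAdicCompletionMap L v w hw] at h
      rw [mul_comm]; exact h.symm
    · rintro ⟨z, hz⟩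
      have hz0 : z ≠ 0 := fun h0 => hlen (by rw [← hz, h0, mul_zero])
      refine ⟨(RingEquiv.piUnique fun w' : PlacesOver L v => w'.1.adicCompletion L).symm z, ?_, ?_⟩
      · exact isUnit_localRing_of_ne_zero_of_subsingleton L v hvs fun h0 => hz0 (by
          have h := congr_fun h0 w
          rwa [show ((RingEquiv.piUnique fun w' : PlacesOver L v => w'.1.adicCompletion L).symm z) w = z from
            (RingEquiv.piUnique fun w' : PlacesOver L v => w'.1.adicCompletion L).apply_symm_apply _] at h)
      · rw [LocalRing.eq_iff_apply_eq (IsCMField.complexConj L) hc w hw, hxw, Pi.mul_apply, conjLocal_apply_eq_galAdicCompletionMap L v w hw,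
          show ((RingEquiv.piUnique fun w' : PlacesOver L v => w'.1.adicCompletion L).symm z) w = z from
            (RingEquiv.piUnique fun w' : PlacesOver L v => w'.1.adicCompletion L).apply_symm_apply _, mul_comm, hz]
  exact if_congr hiff rfl rfl

/-! ## §2 The frame literal and its one-place matrix -/

/-- `IsConj` descends along a multiplicative equivalence. [folklore] -/
private theorem isConj_of_isConj_mulEquiv₃ {G G' : Type*} [Monoid G] [Monoid G'] (e : G ≃* G') {a b : G}
    (h : IsConj (e a) (e b)) : IsConj a b := by
  have h' := MonoidHom.map_isConj e.symm.toMonoidHom h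
  simpa using h'

/-- **THE FRAME LITERAL `t₀` AND ITS ONE-PLACE MATRIX.**  From the wave's frame token `H′_w = (−det H′_w) • ᵗσ̄A·Φ₃·A`: for every `γ_H = (g, u) ∈ H_v` there is `t₀ ∈ G′_v = U(H′)(L⁺_v)`
MATCHED with `γ_H` whose one-place matrix is `(t₀)_w = A⁻¹ · ι(g_w, u_w) · A`, `ι(g, u) = !![g₀₀, 0, g₀₁; 0, u, 0; g₁₀, 0, g₁₁]` (`t₀ := ψ⁻¹(ι_v γ_H)` for the transport
`ψ = localNonsplitCongr … A`, `(ψ x)_w = A x_w A⁻¹`; ★ `exists_isLocalNormPair_of_frame` is the bare existence). [cite: Rogawski1990, §14.2 p. 233; §4.3 p. 43]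
[cite: Jacobowitz1962, §7 Thm. 7.1] -/
theorem exists_isLocalNormPair_coe_eq_of_frame (w : PlacesOver L v) (hw : IsCMField.complexConj L • w.1 = w.1)
    (hH'w : IsUnit (placeForm H' w.1)) (A : GL (Fin 3) (w.1.adicCompletion L))
    (hframe : placeForm H' w.1 = (-(placeForm H' w.1).det) •
      formCongr (galAdicCompletionMap (L := L) (IsCMField.complexConj L) hw) A ((StdForm.antidiagonal 3).over (w.1.adicCompletion L)))
    (γH : (cmDatum L 2 (Matrix.of fun i j : Fin 2 => if i.val + j.val + 1 = 2 then (1 : L) else 0)).Local v ×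
      (cmDatum L 1 (Matrix.of fun i j : Fin 1 => if i.val + j.val + 1 = 1 then (1 : L) else 0)).Local v) :
    ∃ t₀ : (cmDatum L 3 H').Local v, IsLocalNormPair L H' v γH t₀ ∧
      ((localNonsplitEquiv (IsCMField.complexConj L) H' (IsCMField.complexConj_ne_one L) w hw t₀ :
          unitaryGroupOfForm (galAdicCompletionMap (L := L) (IsCMField.complexConj L) hw) (placeForm H' w.1)) : GL (Fin 3) (w.1.adicCompletion L)) =
        A⁻¹ * endoGL
          (((localNonsplitEquiv (IsCMField.complexConj L)
              (Matrix.of fun i j : Fin 2 => if i.val + j.val + 1 = 2 then (1 : L) else 0) (IsCMField.complexConj_ne_one L) w hw γH.1 :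
              unitaryGroupOfForm (galAdicCompletionMap (L := L) (IsCMField.complexConj L) hw)
                (placeForm (Matrix.of fun i j : Fin 2 => if i.val + j.val + 1 = 2 then (1 : L) else 0) w.1)) :
              GL (Fin 2) (w.1.adicCompletion L)),
            ((localNonsplitEquiv (IsCMField.complexConj L)
              (Matrix.of fun i j : Fin 1 => if i.val + j.val + 1 = 1 then (1 : L) else 0) (IsCMField.complexConj_ne_one L) w hw γH.2 :
              unitaryGroupOfForm (galAdicCompletionMap (L := L) (IsCMField.complexConj L) hw)
                (placeForm (Matrix.of fun i j : Fin 1 => if i.val + j.val + 1 = 1 then (1 : L) else 0) w.1)) :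
              GL (Fin 1) (w.1.adicCompletion L))) * A := by
  have hcne := IsCMField.complexConj_ne_one L
  haveI : Algebra.IsQuadraticExtension ↥(maximalRealSubfield L) L := IsCMField.isQuadraticExtension L
  have hd : IsUnit (-(placeForm H' w.1).det) := ((Matrix.isUnit_iff_isUnit_det _).1 hH'w).neg
  have hd0 : (-(placeForm H' w.1).det) ≠ 0 := hd.ne_zero
  have hc : IsUnit (-(placeForm H' w.1).det)⁻¹ := hd.inv
  have h : formCongr (galAdicCompletionMap (L := L) (IsCMField.complexConj L) hw) A
      (placeForm (Matrix.of fun i j : Fin 3 => if i.val + j.val + 1 = 3 then (1 : L) else 0) w.1) = (-(placeForm H' w.1).det)⁻¹ • placeForm H' w.1 := by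
    rw [placeForm_antidiagOne, ← inv_smul_smul₀ hd0 (formCongr (galAdicCompletionMap (L := L) (IsCMField.complexConj L) hw) A
      ((StdForm.antidiagonal 3).over (w.1.adicCompletion L))), ← hframe]
  set ψ := localNonsplitCongr (IsCMField.complexConj L) hcne w hw A hc h with hψ
  set x := endoEmbLocal L v γH with hx
  have hψx := localNonsplitEquiv_localNonsplitCongr (IsCMField.complexConj L) hcne w hw A hc h (ψ.symm x)
  rw [ContinuousMulEquiv.apply_symm_apply] at hψx
  -- `E_w(t₀) = A⁻¹ · E_w(ι_v γ_H) · A`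
  have hconj : ((localNonsplitEquiv (IsCMField.complexConj L) H' hcne w hw (ψ.symm x) :
        unitaryGroupOfForm (galAdicCompletionMap (L := L) (IsCMField.complexConj L) hw) (placeForm H' w.1)) :
        GL (Fin 3) (w.1.adicCompletion L)) =
      A⁻¹ * ((localNonsplitEquiv (IsCMField.complexConj L)
        (Matrix.of fun i j : Fin 3 => if i.val + j.val + 1 = 3 then (1 : L) else 0) hcne w hw x :
        unitaryGroupOfForm (galAdicCompletionMap (L := L) (IsCMField.complexConj L) hw)
          (placeForm (Matrix.of fun i j : Fin 3 => if i.val + j.val + 1 = 3 then (1 : L) else 0) w.1)) :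
        GL (Fin 3) (w.1.adicCompletion L)) * A := by
    rw [hψx]; group
  refine ⟨ψ.symm x, ?_, ?_⟩
  · show IsConj ((x.val : GL (Fin 3) (LocalRing L v))) ((ψ.symm x).val : GL (Fin 3) (LocalRing L v))
    refine isConj_of_isConj_mulEquiv₃
      ((localGLPiEquiv L 3 v).toMulEquiv.trans (localGLPiEvalEquiv (IsCMField.complexConj L) 3 hcne w hw).toMulEquiv) ?_
    show IsConj
      ((localNonsplitEquiv (IsCMField.complexConj L)
        (Matrix.of fun i j : Fin 3 => if i.val + j.val + 1 = 3 then (1 : L) else 0) hcne w hw x :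
        unitaryGroupOfForm (galAdicCompletionMap (L := L) (IsCMField.complexConj L) hw)
          (placeForm (Matrix.of fun i j : Fin 3 => if i.val + j.val + 1 = 3 then (1 : L) else 0) w.1)) :
        GL (Fin 3) (w.1.adicCompletion L))
      ((localNonsplitEquiv (IsCMField.complexConj L) H' hcne w hw (ψ.symm x) :
        unitaryGroupOfForm (galAdicCompletionMap (L := L) (IsCMField.complexConj L) hw) (placeForm H' w.1)) :
        GL (Fin 3) (w.1.adicCompletion L))
    rw [hconj]
    exact isConj_iff.2 ⟨A⁻¹, by group⟩
  · rw [hconj, hx, coe_localNonsplitEquiv_endoEmbLocal L w hw γH]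

/-! ## §3 The κ-sign of the frame literal: `κ_v(γ_H, t₀) = (y_λ, θ)_v` -/

/-- **LENGTH OF THE FRAME'S MIDDLE VECTOR**: `ᵗσ̄(A⁻¹) · H′_w · A⁻¹ = (−det H′_w) • Φ₃` (from the frame token), so the `H′_w`-length of the column `A⁻¹e₁` is `−det H′_w`.
[cite: Rogawski1990, §3.5 Prop. 3.5.2 p. 29] [cite: Jacobowitz1962, §8] -/
theorem sum_sum_inv_col_one_eq_neg_det_of_frame (w : PlacesOver L v) (hw : IsCMField.complexConj L • w.1 = w.1) (A : GL (Fin 3) (w.1.adicCompletion L))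
    (hframe : placeForm H' w.1 = (-(placeForm H' w.1).det) •
      formCongr (galAdicCompletionMap (L := L) (IsCMField.complexConj L) hw) A ((StdForm.antidiagonal 3).over (w.1.adicCompletion L))) :
    (∑ i : Fin 3, ∑ k : Fin 3, galAdicCompletionMap (L := L) (IsCMField.complexConj L) hw (((A⁻¹ : GL (Fin 3) (w.1.adicCompletion L)) : Matrix (Fin 3) (Fin 3) (w.1.adicCompletion L)) i 1) *
        placeForm H' w.1 i k * ((A⁻¹ : GL (Fin 3) (w.1.adicCompletion L)) : Matrix (Fin 3) (Fin 3) (w.1.adicCompletion L)) k 1) = -(placeForm H' w.1).det := by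
  set σ := galAdicCompletionMap (L := L) (IsCMField.complexConj L) hw with hσ
  have h2 : formCongr σ A⁻¹ (placeForm H' w.1) = (-(placeForm H' w.1).det) • (StdForm.antidiagonal 3).over (w.1.adicCompletion L) := by
    conv_lhs => rw [hframe]
    rw [show ∀ (c : w.1.adicCompletion L) (M : Matrix (Fin 3) (Fin 3) (w.1.adicCompletion L)), formCongr σ A⁻¹ (c • M) = c • formCongr σ A⁻¹ M from
      fun c M => by simp only [formCongr, Matrix.mul_smul, Matrix.smul_mul], formCongr_inv_formCongr]
  have h11 : (formCongr σ A⁻¹ (placeForm H' w.1)) 1 1 = -(placeForm H' w.1).det := by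
    rw [h2, Matrix.smul_apply, stdForm_antidiagonal_three_over_eq, smul_eq_mul]
    simp
  rw [← h11, Finset.sum_comm]
  simp only [formCongr, Matrix.mul_apply, Matrix.transpose_apply, Matrix.map_apply, Finset.sum_mul]

/-- **THE κ-SIGN OF THE FRAME LITERAL, NORM FORM**: for `γ_H` with `χ_g(u)` a unit and a match `t₀` whose one-place matrix is `A⁻¹ · ι(g_w, u_w) · A`,
`κ_v(γ_H, t₀) = +1 ⟺ −det H′_w = σ_w(z)·z` for some `z ∈ L_w` (the `u_w`-eigenvector `A⁻¹e₁` has `H′_w`-length `−det H′_w`).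
[cite: Rogawski1990, §4.3 (4.3.2) p. 43; §3.5 Prop. 3.5.2 (c) p. 29] [cite: LanglandsShelstad1987, §1] -/
theorem finKappaAt_eq_ite_of_coe_eq_of_frame (w : PlacesOver L v) (hw : IsCMField.complexConj L • w.1 = w.1)
    (hH'w : IsUnit (placeForm H' w.1)) (A : GL (Fin 3) (w.1.adicCompletion L))
    (hframe : placeForm H' w.1 = (-(placeForm H' w.1).det) •
      formCongr (galAdicCompletionMap (L := L) (IsCMField.complexConj L) hw) A ((StdForm.antidiagonal 3).over (w.1.adicCompletion L)))
    (γH : (cmDatum L 2 (Matrix.of fun i j : Fin 2 => if i.val + j.val + 1 = 2 then (1 : L) else 0)).Local v ×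
      (cmDatum L 1 (Matrix.of fun i j : Fin 1 => if i.val + j.val + 1 = 1 then (1 : L) else 0)).Local v)
    (hu : IsUnit ((finCharpolyTwo L v γH).eval (finGammaTwo L v γH)))
    {t₀ : (cmDatum L 3 H').Local v} (ht₀ : IsLocalNormPair L H' v γH t₀)
    (hmat : ((localNonsplitEquiv (IsCMField.complexConj L) H' (IsCMField.complexConj_ne_one L) w hw t₀ :
          unitaryGroupOfForm (galAdicCompletionMap (L := L) (IsCMField.complexConj L) hw) (placeForm H' w.1)) : GL (Fin 3) (w.1.adicCompletion L)) =
        A⁻¹ * endoGL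
          (((localNonsplitEquiv (IsCMField.complexConj L)
              (Matrix.of fun i j : Fin 2 => if i.val + j.val + 1 = 2 then (1 : L) else 0) (IsCMField.complexConj_ne_one L) w hw γH.1 :
              unitaryGroupOfForm (galAdicCompletionMap (L := L) (IsCMField.complexConj L) hw)
                (placeForm (Matrix.of fun i j : Fin 2 => if i.val + j.val + 1 = 2 then (1 : L) else 0) w.1)) :
              GL (Fin 2) (w.1.adicCompletion L)),
            ((localNonsplitEquiv (IsCMField.complexConj L)
              (Matrix.of fun i j : Fin 1 => if i.val + j.val + 1 = 1 then (1 : L) else 0) (IsCMField.complexConj_ne_one L) w hw γH.2 :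
              unitaryGroupOfForm (galAdicCompletionMap (L := L) (IsCMField.complexConj L) hw)
                (placeForm (Matrix.of fun i j : Fin 1 => if i.val + j.val + 1 = 1 then (1 : L) else 0) w.1)) :
              GL (Fin 1) (w.1.adicCompletion L))) * A) :
    finKappaAt L v H' γH t₀ =
      if ∃ z : w.1.adicCompletion L, galAdicCompletionMap (L := L) (IsCMField.complexConj L) hw z * z = -(placeForm H' w.1).det then 1 else -1 := by
  set σ := galAdicCompletionMap (L := L) (IsCMField.complexConj L) hw with hσ
  set Ai : Matrix (Fin 3) (Fin 3) (w.1.adicCompletion L) := ((A⁻¹ : GL (Fin 3) (w.1.adicCompletion L)) : Matrix (Fin 3) (Fin 3) (w.1.adicCompletion L)) with hAi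
  -- the eigenvector `q = A⁻¹ e₁`
  set q : Fin 3 → w.1.adicCompletion L := fun i => Ai i 1 with hqdef
  have hAAi : (A : Matrix (Fin 3) (Fin 3) (w.1.adicCompletion L)) * Ai = 1 := by
    rw [hAi, ← Units.val_mul, mul_inv_cancel, Units.val_one]
  -- `ι e₁ = u_w e₁`
  have hιq : ∀ i : Fin 3, ∑ k : Fin 3, ((endoGL
          (((localNonsplitEquiv (IsCMField.complexConj L)
              (Matrix.of fun i j : Fin 2 => if i.val + j.val + 1 = 2 then (1 : L) else 0) (IsCMField.complexConj_ne_one L) w hw γH.1 :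
              unitaryGroupOfForm (galAdicCompletionMap (L := L) (IsCMField.complexConj L) hw)
                (placeForm (Matrix.of fun i j : Fin 2 => if i.val + j.val + 1 = 2 then (1 : L) else 0) w.1)) :
              GL (Fin 2) (w.1.adicCompletion L)),
            ((localNonsplitEquiv (IsCMField.complexConj L)
              (Matrix.of fun i j : Fin 1 => if i.val + j.val + 1 = 1 then (1 : L) else 0) (IsCMField.complexConj_ne_one L) w hw γH.2 :
              unitaryGroupOfForm (galAdicCompletionMap (L := L) (IsCMField.complexConj L) hw)
                (placeForm (Matrix.of fun i j : Fin 1 => if i.val + j.val + 1 = 1 then (1 : L) else 0) w.1)) :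
              GL (Fin 1) (w.1.adicCompletion L))) : GL (Fin 3) (w.1.adicCompletion L)) : Matrix (Fin 3) (Fin 3) (w.1.adicCompletion L)) i k *
      (Pi.single (1 : Fin 3) (1 : w.1.adicCompletion L) : Fin 3 → w.1.adicCompletion L) k =
        finGammaTwo L v γH w * (Pi.single (1 : Fin 3) (1 : w.1.adicCompletion L) : Fin 3 → w.1.adicCompletion L) i := by
    intro i
    rw [coe_endoGL_eq]
    have hu' : (((localNonsplitEquiv (IsCMField.complexConj L)
        (Matrix.of fun i j : Fin 1 => if i.val + j.val + 1 = 1 then (1 : L) else 0) (IsCMField.complexConj_ne_one L) w hw γH.2 :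
        unitaryGroupOfForm (galAdicCompletionMap (L := L) (IsCMField.complexConj L) hw)
          (placeForm (Matrix.of fun i j : Fin 1 => if i.val + j.val + 1 = 1 then (1 : L) else 0) w.1)) :
        GL (Fin 1) (w.1.adicCompletion L)) : Matrix (Fin 1) (Fin 1) (w.1.adicCompletion L)) 0 0 = finGammaTwo L v γH w := rfl
    fin_cases i <;> simp [Pi.single_apply, hu']
  -- `t₀,w q = u_w q`
  have hq : (((localNonsplitEquiv (IsCMField.complexConj L) H' (IsCMField.complexConj_ne_one L) w hw t₀ :
          unitaryGroupOfForm (galAdicCompletionMap (L := L) (IsCMField.complexConj L) hw) (placeForm H' w.1)) : GL (Fin 3) (w.1.adicCompletion L)) : Matrix (Fin 3) (Fin 3) (w.1.adicCompletion L)) *ᵥ q = finGammaTwo L v γH w • q := by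
    have hqe : q = Ai *ᵥ (Pi.single (1 : Fin 3) (1 : w.1.adicCompletion L)) := by
      funext i; simp [hqdef, Matrix.mulVec, dotProduct, Pi.single_apply]
    rw [hmat, Units.val_mul, Units.val_mul, hqe, Matrix.mulVec_mulVec, Matrix.mul_assoc, ← hAi, hAAi, Matrix.mul_one, ← Matrix.mulVec_mulVec]
    have hιe : ((endoGL
          (((localNonsplitEquiv (IsCMField.complexConj L)
              (Matrix.of fun i j : Fin 2 => if i.val + j.val + 1 = 2 then (1 : L) else 0) (IsCMField.complexConj_ne_one L) w hw γH.1 :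
              unitaryGroupOfForm (galAdicCompletionMap (L := L) (IsCMField.complexConj L) hw)
                (placeForm (Matrix.of fun i j : Fin 2 => if i.val + j.val + 1 = 2 then (1 : L) else 0) w.1)) :
              GL (Fin 2) (w.1.adicCompletion L)),
            ((localNonsplitEquiv (IsCMField.complexConj L)
              (Matrix.of fun i j : Fin 1 => if i.val + j.val + 1 = 1 then (1 : L) else 0) (IsCMField.complexConj_ne_one L) w hw γH.2 :
              unitaryGroupOfForm (galAdicCompletionMap (L := L) (IsCMField.complexConj L) hw)
                (placeForm (Matrix.of fun i j : Fin 1 => if i.val + j.val + 1 = 1 then (1 : L) else 0) w.1)) :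
              GL (Fin 1) (w.1.adicCompletion L))) : GL (Fin 3) (w.1.adicCompletion L)) : Matrix (Fin 3) (Fin 3) (w.1.adicCompletion L)) *ᵥ
        (Pi.single (1 : Fin 3) (1 : w.1.adicCompletion L)) = finGammaTwo L v γH w • (Pi.single (1 : Fin 3) (1 : w.1.adicCompletion L) : Fin 3 → w.1.adicCompletion L) := by
      funext i
      rw [Matrix.mulVec, dotProduct, Pi.smul_apply, smul_eq_mul]
      exact hιq i
    rw [hιe, Matrix.mulVec_smul]
  -- `q ≠ 0` (a column of the invertible `A⁻¹`)
  have hq0 : q ≠ 0 := fun h0 => by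
    have hcol : ∀ i, Ai i 1 = 0 := fun i => by
      have h := congr_fun h0 i
      simpa [hqdef] using h
    have hdet : Ai.det = 0 := Matrix.det_eq_zero_of_column_eq_zero 1 hcol
    exact (Matrix.isUnits_det_units (A⁻¹ : GL (Fin 3) (w.1.adicCompletion L))) |>.ne_zero hdet
  -- the length of `q` is `−det H′_w ≠ 0`
  have hlen : (∑ i : Fin 3, ∑ k : Fin 3, σ (q i) * placeForm H' w.1 i k * q k) = -(placeForm H' w.1).det :=
    sum_sum_inv_col_one_eq_neg_det_of_frame L H' w hw A hframe
  have hdet0 : -(placeForm H' w.1).det ≠ 0 := (((Matrix.isUnit_iff_isUnit_det _).1 hH'w).neg).ne_zero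
  have hlen0 : (∑ i : Fin 3, ∑ k : Fin 3, σ (q i) * placeForm H' w.1 i k * q k) ≠ 0 := by rw [hlen]; exact hdet0
  rw [finKappaAt_eq_ite_of_onePlace_eigenvector L H' w hw γH hu ht₀ hq hq0 hlen0, hlen]

/-- **THE κ-SIGN OF THE FRAME LITERAL IS `(y_λ, θ)_v`**: with the wave's symbol argument `ι_w y_λ = −det H′_w` (binder `hyl`), `κ_v(γ_H, t₀) = (y_λ, θ)_v` — by ★
`hilbertSymbol_eq_one_iff_exists_norm_toPlace` (`(y, θ)_v = 1 ⟺ ι_w y ∈ N(L_w^×)`). [cite: Rogawski1990, §4.3 (4.3.2) p. 43; §4.9 Prop. 4.9.1 p. 55] [cite: LanglandsShelstad1987, §1] -/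
theorem finKappaAt_eq_hilbertSymbol_of_coe_eq_of_frame (w : PlacesOver L v) (hw : IsCMField.complexConj L • w.1 = w.1)
    (hH'w : IsUnit (placeForm H' w.1)) (A : GL (Fin 3) (w.1.adicCompletion L))
    (hframe : placeForm H' w.1 = (-(placeForm H' w.1).det) •
      formCongr (galAdicCompletionMap (L := L) (IsCMField.complexConj L) hw) A ((StdForm.antidiagonal 3).over (w.1.adicCompletion L)))
    (yl : v.adicCompletion ↥(maximalRealSubfield L)) (hyl : toPlace v w yl = -(placeForm H' w.1).det)
    (γH : (cmDatum L 2 (Matrix.of fun i j : Fin 2 => if i.val + j.val + 1 = 2 then (1 : L) else 0)).Local v ×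
      (cmDatum L 1 (Matrix.of fun i j : Fin 1 => if i.val + j.val + 1 = 1 then (1 : L) else 0)).Local v)
    (hu : IsUnit ((finCharpolyTwo L v γH).eval (finGammaTwo L v γH)))
    {t₀ : (cmDatum L 3 H').Local v} (ht₀ : IsLocalNormPair L H' v γH t₀)
    (hmat : ((localNonsplitEquiv (IsCMField.complexConj L) H' (IsCMField.complexConj_ne_one L) w hw t₀ :
          unitaryGroupOfForm (galAdicCompletionMap (L := L) (IsCMField.complexConj L) hw) (placeForm H' w.1)) : GL (Fin 3) (w.1.adicCompletion L)) =
        A⁻¹ * endoGL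
          (((localNonsplitEquiv (IsCMField.complexConj L)
              (Matrix.of fun i j : Fin 2 => if i.val + j.val + 1 = 2 then (1 : L) else 0) (IsCMField.complexConj_ne_one L) w hw γH.1 :
              unitaryGroupOfForm (galAdicCompletionMap (L := L) (IsCMField.complexConj L) hw)
                (placeForm (Matrix.of fun i j : Fin 2 => if i.val + j.val + 1 = 2 then (1 : L) else 0) w.1)) :
              GL (Fin 2) (w.1.adicCompletion L)),
            ((localNonsplitEquiv (IsCMField.complexConj L)
              (Matrix.of fun i j : Fin 1 => if i.val + j.val + 1 = 1 then (1 : L) else 0) (IsCMField.complexConj_ne_one L) w hw γH.2 :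
              unitaryGroupOfForm (galAdicCompletionMap (L := L) (IsCMField.complexConj L) hw)
                (placeForm (Matrix.of fun i j : Fin 1 => if i.val + j.val + 1 = 1 then (1 : L) else 0) w.1)) :
              GL (Fin 1) (w.1.adicCompletion L))) * A) :
    finKappaAt L v H' γH t₀ = hilbertSymbol (v.adicCompletion ↥(maximalRealSubfield L)) yl
        (algebraMap ↥(maximalRealSubfield L) _ ((cmQuadraticGenerator L : 𝓞 ↥(maximalRealSubfield L)) : ↥(maximalRealSubfield L))) := by
  have hdet0 : -(placeForm H' w.1).det ≠ 0 := (((Matrix.isUnit_iff_isUnit_det _).1 hH'w).neg).ne_zero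
  have hy0 : yl ≠ 0 := fun h0 => hdet0 (by rw [← hyl, h0, map_zero])
  rw [finKappaAt_eq_ite_of_coe_eq_of_frame L H' w hw hH'w A hframe γH hu ht₀ hmat, ← hyl]
  rcases hilbertSymbol_eq_one_or_eq_neg_one yl
      (algebraMap ↥(maximalRealSubfield L) _ ((cmQuadraticGenerator L : 𝓞 ↥(maximalRealSubfield L)) : ↥(maximalRealSubfield L))) with h1 | h1
  · rw [if_pos ((hilbertSymbol_eq_one_iff_exists_norm_toPlace L v w hw hy0).1 h1), h1]
  · have hne : ¬ ∃ z : w.1.adicCompletion L, galAdicCompletionMap (L := L) (IsCMField.complexConj L) hw z * z = toPlace v w yl := fun hex => by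
      have h := (hilbertSymbol_eq_one_iff_exists_norm_toPlace L v w hw hy0).2 hex
      rw [h] at h1
      exact absurd h1 (by decide)
    rw [if_neg hne, h1]

/-! ## §4 The depth of the frame literal on the 2-deep tube (ramified `w`: `ι_w ϖ_v ~ ϖ_w²`) -/

/-- `|c⁻¹x| ≤ 1` when `|x| ≤ |c|`, `c ≠ 0`. [folklore] -/
private theorem valued_inv_mul_le_one₂ {K : Type*} [Field K] [Valued K (WithZero (Multiplicative ℤ))] {c x : K} (hc : c ≠ 0) (h : Valued.v x ≤ Valued.v c) :
    Valued.v (c⁻¹ * x) ≤ 1 := by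
  have hvc : Valued.v c ≠ 0 := (Valuation.ne_zero_iff _).2 hc
  rw [Valuation.map_mul, map_inv₀]
  calc (Valued.v c)⁻¹ * Valued.v x ≤ (Valued.v c)⁻¹ * Valued.v c := mul_le_mul' le_rfl h
    _ = 1 := inv_mul_cancel₀ hvc

/-- **CONJUGATES OF 2-DEEP MATRICES BY AN INTEGRAL FRAME ARE v-DEEP** (conjugate-general form, for the literals lineage A-p19 (g28)): at a ramified `w`
(`|ι_w ϖ_v|_w = |ϖ_w|²`), if `A ∈ GL₃(𝒪_w)`, `Y ≡ 1 (mod ϖ_w²)` entrywise and `t ∈ G′_v` has one-place matrix `A⁻¹ · Y · A`, then `(t)_w ≡ 1 (mod ι_w ϖ_v)` entrywise —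
the «v-DEEP» clause of the (Lit2) socket for `t`, verbatim. [cite: Rogawski1990, §4.9 p. 55] [cite: Jacobowitz1962, §8] -/
theorem vDeep_of_coe_eq_conj_of_entrywise_le (w : PlacesOver L v) (hw : IsCMField.complexConj L • w.1 = w.1) (he : v.asIdeal.ramificationIdx' w.1.asIdeal ≠ 1)
    (ϖ : w.1.adicCompletion L) (hϖ : Valued.v ϖ = WithZero.exp (-1 : ℤ))
    (A : GL (Fin 3) (w.1.adicCompletion L)) (hA : A ∈ glInt 3 (w.1.adicCompletion L))
    (Y : GL (Fin 3) (w.1.adicCompletion L))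
    (hY : ∀ i j : Fin 3, Valued.v ((Y : Matrix (Fin 3) (Fin 3) (w.1.adicCompletion L)) i j - (1 : Matrix (Fin 3) (Fin 3) (w.1.adicCompletion L)) i j) ≤ Valued.v (ϖ ^ 2))
    {t : (cmDatum L 3 H').Local v}
    (hmat : ((localNonsplitEquiv (IsCMField.complexConj L) H' (IsCMField.complexConj_ne_one L) w hw t :
          unitaryGroupOfForm (galAdicCompletionMap (L := L) (IsCMField.complexConj L) hw) (placeForm H' w.1)) : GL (Fin 3) (w.1.adicCompletion L)) = A⁻¹ * Y * A) :
    (∀ a b, Valued.v (((toPlace v w (HeckeCharacter.uniformizer ↥(maximalRealSubfield L) v : v.adicCompletion ↥(maximalRealSubfield L))) ^ 1)⁻¹ * ((((t).val : GL (Fin 3) (UnitaryGroup.LocalRing L v)).val.map (Pi.evalRingHom (fun w' : PlacesOver L v => w'.1.adicCompletion L) w)) a b - (1 : Matrix (Fin 3) (Fin 3) (w.1.adicCompletion L)) a b)) ≤ 1) := by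
  haveI : Algebra.IsQuadraticExtension ↥(maximalRealSubfield L) L := IsCMField.isQuadraticExtension L
  set Am : Matrix (Fin 3) (Fin 3) (w.1.adicCompletion L) := (A : Matrix (Fin 3) (Fin 3) (w.1.adicCompletion L)) with hAm
  set Ai : Matrix (Fin 3) (Fin 3) (w.1.adicCompletion L) := ((A⁻¹ : GL (Fin 3) (w.1.adicCompletion L)) : Matrix (Fin 3) (Fin 3) (w.1.adicCompletion L)) with hAi
  have hAiA : Ai * Am = 1 := by
    rw [hAi, hAm, ← Units.val_mul, inv_mul_cancel, Units.val_one]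
  have hAint : ∀ a b, Valued.v (Am a b) ≤ 1 := fun a b =>
    (v_le_one_iff_valuation_le_one _).2 ((Valuation.mem_integer_iff _ _).1 (((mem_glInt_iff _).1 hA).1 a b))
  have hAiint : ∀ a b, Valued.v (Ai a b) ≤ 1 := fun a b =>
    (v_le_one_iff_valuation_le_one _).2 ((Valuation.mem_integer_iff _ _).1 (((mem_glInt_iff _).1 hA).2 a b))
  -- the one-place matrix of `t` is `A⁻¹ Y A`, so `t_w − 1 = A⁻¹ (Y − 1) A`
  have hE : (((t).val : GL (Fin 3) (UnitaryGroup.LocalRing L v)).val.map (Pi.evalRingHom (fun w' : PlacesOver L v => w'.1.adicCompletion L) w)) =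
      Ai * (Y : Matrix (Fin 3) (Fin 3) (w.1.adicCompletion L)) * Am := by
    rw [← coe_localNonsplitEquiv_apply L H' v w hw t, hmat, Units.val_mul, Units.val_mul]
  have hsub : Ai * (Y : Matrix (Fin 3) (Fin 3) (w.1.adicCompletion L)) * Am - 1 = Ai * ((Y : Matrix (Fin 3) (Fin 3) (w.1.adicCompletion L)) - 1) * Am := by
    rw [Matrix.mul_sub, Matrix.sub_mul, Matrix.mul_one, hAiA]
  have hYe : ∀ c d : Fin 3, Valued.v (((Y : Matrix (Fin 3) (Fin 3) (w.1.adicCompletion L)) - 1) c d) ≤ Valued.v (ϖ ^ 2) := fun c d => by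
    rw [Matrix.sub_apply]; exact hY c d
  -- hence entries of `A⁻¹ (Y − 1) A` are `≤ |ϖ²|`
  have hprod : ∀ a b : Fin 3, Valued.v ((Ai * ((Y : Matrix (Fin 3) (Fin 3) (w.1.adicCompletion L)) - 1) * Am) a b) ≤ Valued.v (ϖ ^ 2) := by
    intro a b
    rw [Matrix.mul_apply]
    refine Valuation.map_sum_le _ fun d _ => ?_
    rw [Valuation.map_mul, Matrix.mul_apply]
    have h1 : Valued.v (∑ c : Fin 3, Ai a c * (((Y : Matrix (Fin 3) (Fin 3) (w.1.adicCompletion L)) - 1) c d)) ≤ Valued.v (ϖ ^ 2) := by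
      refine Valuation.map_sum_le _ fun c _ => ?_
      rw [Valuation.map_mul]
      calc Valued.v (Ai a c) * Valued.v ((((Y : Matrix (Fin 3) (Fin 3) (w.1.adicCompletion L)) - 1) c d))
          ≤ 1 * Valued.v (ϖ ^ 2) := mul_le_mul' (hAiint a c) (hYe c d)
        _ = Valued.v (ϖ ^ 2) := one_mul _
    calc Valued.v (∑ c : Fin 3, Ai a c * (((Y : Matrix (Fin 3) (Fin 3) (w.1.adicCompletion L)) - 1) c d)) * Valued.v (Am d b)
        ≤ Valued.v (ϖ ^ 2) * 1 := mul_le_mul' h1 (hAint d b)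
      _ = Valued.v (ϖ ^ 2) := mul_one _
  -- `|ι_w ϖ_v| = |ϖ_w²|`
  have hπ : Valued.v ((toPlace v w (HeckeCharacter.uniformizer ↥(maximalRealSubfield L) v : v.adicCompletion ↥(maximalRealSubfield L))) ^ 1) = Valued.v (ϖ ^ 2) := by
    rw [pow_one, valued_toPlace_eq_sq_of_ramified L v w hw he, HeckeCharacter.valued_uniformizer, Valuation.map_pow, hϖ]
  have hπ0 : (toPlace v w (HeckeCharacter.uniformizer ↥(maximalRealSubfield L) v : v.adicCompletion ↥(maximalRealSubfield L))) ^ 1 ≠ 0 := by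
    intro h0
    have h := congrArg (Valued.v : w.1.adicCompletion L → _) h0
    rw [hπ, map_zero, Valuation.map_pow, hϖ] at h
    exact (pow_ne_zero _ WithZero.coe_ne_zero) h
  intro a b
  refine valued_inv_mul_le_one₂ hπ0 ?_
  rw [hπ]
  have h := hprod a b
  rw [← hsub, ← hE] at h
  rw [← Matrix.sub_apply]
  exact h

/-- **THE FRAME LITERAL IS v-DEEP ON THE 2-DEEP TUBE**: at a ramified `w` (`|ι_w ϖ_v|_w = |ϖ_w|²`), if `A ∈ GL₃(𝒪_w)`, `g_w ≡ 1` and `u_w ≡ 1 (mod ϖ_w²)` entrywise, then the element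
`t₀` with one-place matrix `A⁻¹ · ι(g_w, u_w) · A` satisfies `(t₀)_w ≡ 1 (mod ι_w ϖ_v)` entrywise — the «v-DEEP» clause of the (Lit2) socket verbatim.
[cite: Rogawski1990, §4.9 p. 55] [cite: Jacobowitz1962, §8] -/
theorem vDeep_of_coe_eq_of_frame (w : PlacesOver L v) (hw : IsCMField.complexConj L • w.1 = w.1) (he : v.asIdeal.ramificationIdx' w.1.asIdeal ≠ 1)
    (ϖ : w.1.adicCompletion L) (hϖ : Valued.v ϖ = WithZero.exp (-1 : ℤ))
    (A : GL (Fin 3) (w.1.adicCompletion L)) (hA : A ∈ glInt 3 (w.1.adicCompletion L))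
    (γH : (cmDatum L 2 (Matrix.of fun i j : Fin 2 => if i.val + j.val + 1 = 2 then (1 : L) else 0)).Local v ×
      (cmDatum L 1 (Matrix.of fun i j : Fin 1 => if i.val + j.val + 1 = 1 then (1 : L) else 0)).Local v)
    (hg : ∀ i j : Fin 2, Valued.v ((((γH.1.val : GL (Fin 2) (UnitaryGroup.LocalRing L v)).val.map (Pi.evalRingHom (fun w' : PlacesOver L v => w'.1.adicCompletion L) w)) - 1) i j) ≤ Valued.v (ϖ ^ 2))
    (hu2 : Valued.v (finGammaTwo L v γH w - 1) ≤ Valued.v (ϖ ^ 2))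
    {t₀ : (cmDatum L 3 H').Local v}
    (hmat : ((localNonsplitEquiv (IsCMField.complexConj L) H' (IsCMField.complexConj_ne_one L) w hw t₀ :
          unitaryGroupOfForm (galAdicCompletionMap (L := L) (IsCMField.complexConj L) hw) (placeForm H' w.1)) : GL (Fin 3) (w.1.adicCompletion L)) =
        A⁻¹ * endoGL
          (((localNonsplitEquiv (IsCMField.complexConj L)
              (Matrix.of fun i j : Fin 2 => if i.val + j.val + 1 = 2 then (1 : L) else 0) (IsCMField.complexConj_ne_one L) w hw γH.1 :
              unitaryGroupOfForm (galAdicCompletionMap (L := L) (IsCMField.complexConj L) hw)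
                (placeForm (Matrix.of fun i j : Fin 2 => if i.val + j.val + 1 = 2 then (1 : L) else 0) w.1)) :
              GL (Fin 2) (w.1.adicCompletion L)),
            ((localNonsplitEquiv (IsCMField.complexConj L)
              (Matrix.of fun i j : Fin 1 => if i.val + j.val + 1 = 1 then (1 : L) else 0) (IsCMField.complexConj_ne_one L) w hw γH.2 :
              unitaryGroupOfForm (galAdicCompletionMap (L := L) (IsCMField.complexConj L) hw)
                (placeForm (Matrix.of fun i j : Fin 1 => if i.val + j.val + 1 = 1 then (1 : L) else 0) w.1)) :
              GL (Fin 1) (w.1.adicCompletion L))) * A) :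
    (∀ a b, Valued.v (((toPlace v w (HeckeCharacter.uniformizer ↥(maximalRealSubfield L) v : v.adicCompletion ↥(maximalRealSubfield L))) ^ 1)⁻¹ * ((((t₀).val : GL (Fin 3) (UnitaryGroup.LocalRing L v)).val.map (Pi.evalRingHom (fun w' : PlacesOver L v => w'.1.adicCompletion L) w)) a b - (1 : Matrix (Fin 3) (Fin 3) (w.1.adicCompletion L)) a b)) ≤ 1) := by
  -- entries of `ι(g_w, u_w) − 1` are `≤ |ϖ²|`, then the conjugate-general lemma
  have hu' : (((localNonsplitEquiv (IsCMField.complexConj L)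
      (Matrix.of fun i j : Fin 1 => if i.val + j.val + 1 = 1 then (1 : L) else 0) (IsCMField.complexConj_ne_one L) w hw γH.2 :
      unitaryGroupOfForm (galAdicCompletionMap (L := L) (IsCMField.complexConj L) hw)
        (placeForm (Matrix.of fun i j : Fin 1 => if i.val + j.val + 1 = 1 then (1 : L) else 0) w.1)) :
      GL (Fin 1) (w.1.adicCompletion L)) : Matrix (Fin 1) (Fin 1) (w.1.adicCompletion L)) 0 0 = finGammaTwo L v γH w := rfl
  have hg' : (((localNonsplitEquiv (IsCMField.complexConj L)
      (Matrix.of fun i j : Fin 2 => if i.val + j.val + 1 = 2 then (1 : L) else 0) (IsCMField.complexConj_ne_one L) w hw γH.1 :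
      unitaryGroupOfForm (galAdicCompletionMap (L := L) (IsCMField.complexConj L) hw)
        (placeForm (Matrix.of fun i j : Fin 2 => if i.val + j.val + 1 = 2 then (1 : L) else 0) w.1)) :
      GL (Fin 2) (w.1.adicCompletion L)) : Matrix (Fin 2) (Fin 2) (w.1.adicCompletion L)) =
        ((γH.1.val : GL (Fin 2) (UnitaryGroup.LocalRing L v)).val.map (Pi.evalRingHom (fun w' : PlacesOver L v => w'.1.adicCompletion L) w)) := rfl
  have hg00 := hg 0 0
  have hg01 := hg 0 1
  have hg10 := hg 1 0
  have hg11 := hg 1 1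
  simp only [Matrix.sub_apply, Matrix.one_apply_eq, Matrix.one_apply_ne (show (0 : Fin 2) ≠ 1 by decide),
    Matrix.one_apply_ne (show (1 : Fin 2) ≠ 0 by decide), sub_zero] at hg00 hg01 hg10 hg11
  refine vDeep_of_coe_eq_conj_of_entrywise_le L H' w hw he ϖ hϖ A hA _ (fun c d => ?_) hmat
  rw [coe_endoGL_eq, hg', hu']
  fin_cases c <;> fin_cases d <;>
    [simpa using hg00; simp; simpa using hg01; simp; simpa using hu2; simp; simpa using hg10; simp; simpa using hg11]

/-! ## §5 Package: the v-deep frame literal of sign `(y_λ, θ)_v` -/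

/-- **THE TYPE-(2) FRAME LITERAL, PACKAGED** ((Lit2) first half): at a ramified `w ∣ v` with the wave's integral antidiagonal frame `A ∈ GL₃(𝒪_w)`,
`H′_w = (−det H′_w) • ᵗσ̄A·Φ₃·A`, symbol argument `ι_w y_λ = −det H′_w`, for every `γ_H = (g, u)` with `χ_g(u)` a unit (e.g. `G`-regular) in the 2-DEEP TUBE
(`g_w ≡ 1`, `u_w ≡ 1 (mod ϖ_w²)`): there is `t₀ ∈ G′_v` MATCHED with `γ_H`, v-DEEP (`(t₀)_w ≡ 1 (mod ι_w ϖ_v)` entrywise), with `κ_v(γ_H, t₀) = (y_λ, θ)_v`.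
(`t₀ = ψ_A⁻¹(ι_v γ_H)`, §2–§4.)  The literal of the opposite sign is the organ's second half. [cite: Rogawski1990, §4.9 Prop. 4.9.1 p. 55; §4.3 (4.3.2) p. 43; §14.2 p. 233]
[cite: LanglandsShelstad1987, §1] [cite: Jacobowitz1962, §7 Thm. 7.1] -/
theorem exists_vDeep_frameLiteral_ram (w : PlacesOver L v) (hw : IsCMField.complexConj L • w.1 = w.1) (he : v.asIdeal.ramificationIdx' w.1.asIdeal ≠ 1)
    (hH'w : IsUnit (placeForm H' w.1)) (ϖ : w.1.adicCompletion L) (hϖ : Valued.v ϖ = WithZero.exp (-1 : ℤ))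
    (A : GL (Fin 3) (w.1.adicCompletion L)) (hA : A ∈ glInt 3 (w.1.adicCompletion L))
    (hframe : placeForm H' w.1 = (-(placeForm H' w.1).det) •
      formCongr (galAdicCompletionMap (L := L) (IsCMField.complexConj L) hw) A ((StdForm.antidiagonal 3).over (w.1.adicCompletion L)))
    (yl : v.adicCompletion ↥(maximalRealSubfield L)) (hyl : toPlace v w yl = -(placeForm H' w.1).det)
    (γH : (cmDatum L 2 (Matrix.of fun i j : Fin 2 => if i.val + j.val + 1 = 2 then (1 : L) else 0)).Local v ×
      (cmDatum L 1 (Matrix.of fun i j : Fin 1 => if i.val + j.val + 1 = 1 then (1 : L) else 0)).Local v)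
    (hu : IsUnit ((finCharpolyTwo L v γH).eval (finGammaTwo L v γH)))
    (hg : ∀ i j : Fin 2, Valued.v ((((γH.1.val : GL (Fin 2) (UnitaryGroup.LocalRing L v)).val.map (Pi.evalRingHom (fun w' : PlacesOver L v => w'.1.adicCompletion L) w)) - 1) i j) ≤ Valued.v (ϖ ^ 2))
    (hu2 : Valued.v (finGammaTwo L v γH w - 1) ≤ Valued.v (ϖ ^ 2)) :
    ∃ t₀ : (cmDatum L 3 H').Local v, IsLocalNormPair L H' v γH t₀ ∧
      (∀ a b, Valued.v (((toPlace v w (HeckeCharacter.uniformizer ↥(maximalRealSubfield L) v : v.adicCompletion ↥(maximalRealSubfield L))) ^ 1)⁻¹ * ((((t₀).val : GL (Fin 3) (UnitaryGroup.LocalRing L v)).val.map (Pi.evalRingHom (fun w' : PlacesOver L v => w'.1.adicCompletion L) w)) a b - (1 : Matrix (Fin 3) (Fin 3) (w.1.adicCompletion L)) a b)) ≤ 1) ∧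
      finKappaAt L v H' γH t₀ = hilbertSymbol (v.adicCompletion ↥(maximalRealSubfield L)) yl
        (algebraMap ↥(maximalRealSubfield L) _ ((cmQuadraticGenerator L : 𝓞 ↥(maximalRealSubfield L)) : ↥(maximalRealSubfield L))) := by
  obtain ⟨t₀, ht₀, hmat⟩ := exists_isLocalNormPair_coe_eq_of_frame L H' w hw hH'w A hframe γH
  exact ⟨t₀, ht₀, vDeep_of_coe_eq_of_frame L H' w hw he ϖ hϖ A hA γH hg hu2 hmat,
    finKappaAt_eq_hilbertSymbol_of_coe_eq_of_frame L H' w hw hH'w A hframe yl hyl γH hu ht₀ hmat⟩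

end CM

end Literature.NumberTheory.Rogawski1990

end
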